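import Summits.CriticalPhenomena.SAWScalingLimit.Theorems.SAWDevelopingMapInteriorFlatteningLiouvilleCompactness
import Summits.CriticalPhenomena.SAWScalingLimit.Theorems.SAWDevelopingMapInteriorFlatteningLiouvilleNecessity
import Summits.CriticalPhenomena.SAWScalingLimit.Theorems.SAWDevelopingMapInteriorFlatteningLiouvilleBulkNoFold

/-!
# `InteriorFlattening` is a lattice Liouville theorem: crux `⟺` bulk no-fold `∧` uniqueness of local limits

Crux `stmt-CriticalPhenomena-8297` (`Summit.CriticalPhenomena.SAWScalingLimit.Theses.SAWDevelopingMap.InteriorFlattening`,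
(M) of route `SAWDevelopingMap`), line `liouville-local-limits`, lead `prover-line-stmt-CriticalPhenomena-8297-c2-0`
(cycle 2). This file records, sorry-free, what the landed part of the line already proves about the crux ITSELF:

  `InteriorFlattening ⟺ BulkNoFold ∧ LocalLimits.Subsingleton ⟺ BulkNoFold ∧ LocalLimits ⊆ {constThird}`

(`interiorFlattening_iff_bulkNoFold_and_subsingleton`, the registered sub-goal, and
`interiorFlattening_iff_bulkNoFold_and_subset_constThird`), where

* `BulkNoFold := ∃ k R₀, 0 ≤ k ∧ k < 1 ∧ RatioAtDepth R₀ k` is the line's S1 (some `k < 1` bounds the Beltrami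
  quotient `‖F₀ + ωF₁ + ω²F₂‖ / ‖F₀ + F₁ + F₂‖` at every `R₀`-deep vertex of every simply connected domain with a
  boundary root; implied by the crux at `ε = 1/2` and by the route's `NoFoldBound`);
* `LocalLimits` (Defs) is the class of pointwise limits of `M(O)`-normalised DCS observables of admissible
  configurations recentred at the origin vertex `O` with depth `→ ∞`, and `constThird` (Necessity) is the field
  `≡ 1/3` on edges.

So, modulo the (K)-lite no-fold input, the crux (DCS's "same limit regardless of the orientation of the edge",
arXiv:1007.0575 p. 7, made pointwise and uniform) is EXACTLY the statement that the critical hexagonal-lattice SAW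
observable has no lattice-scale memory of its far field: every local limit is the constant. Directions:
`→` is `BulkNoFold.bulkNoFold_of_interiorFlattening` (…LiouvilleBulkNoFold, ε = 1/2) plus `localLimits_subset_of_interiorFlattening`
(…LiouvilleNecessity: flat in every frame at every vertex ⇒ constant on the connected edge graph); `←` is the
line's composition with S4–S7 removed: by S2 (`stub_compactnessAtOrigin`, …LiouvilleCompactness) a failure of the
crux at every depth yields a normalised local limit `G`, `ε`-bad at `O`, whose `120°`-rotation `G ∘ rotO` is again
a local limit; uniqueness gives `G ∘ rotO = G`, so the three values of `G` around `O` coincide and the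
`ω`-combination vanishes in every frame (`1 + ω + ω² = 0`) while the monopole is `1` — contradiction.
What remains open of the crux is therefore precisely: S1 (⇐ `NoFoldBound`, stmt-CriticalPhenomena-8296) and the
Liouville uniqueness `LocalLimits.Subsingleton`, which the line further reduces (S7, …LiouvilleReduction, landed)
to picture-domain limits (S5) plus the two windowed far-field bets (S6, S6').

Sources: H. Duminil-Copin, S. Smirnov, Ann. of Math. 175 (2012) 1653–1665 (arXiv:1007.0575), §2, Lemma 1 and
p. 7; the line card `Cruxes/InteriorFlattening/Lines/liouville-local-limits.md`.
-/

noncomputable section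

open scoped BigOperators Topology
open Filter Literature.Probability.LatticeModels Literature.Probability.RandomPlanarGeometry.SAW

namespace Summit.CriticalPhenomena.SAWScalingLimit.Theorems.InteriorFlattening.Liouville

namespace Equivalence

/-- `rotO` fixes `O`. -/
theorem rotO_O : rotO O = O := by rw [Compactness.rotO_eq]; exact Compactness.rot_O

/-- `rotO` maps `A ↦ B`. -/
theorem rotO_nbA : rotO nbA = nbB := by rw [Compactness.rotO_eq]; exact Compactness.rot_nbA

/-- `rotO` maps `B ↦ C`. -/
theorem rotO_nbB : rotO nbB = nbC := by rw [Compactness.rotO_eq]; exact Compactness.rot_nbB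

/-- **A rotation-invariant field is flat at `O`**: if `G ∘ rotO = G` then `G` takes one value on the
three edges of `O`, so its monopole in any frame at `O` is `3 G{O,A}` and its `ω`-combination in any
frame at `O` vanishes. -/
theorem modes_of_rot_invariant {G : Sym2 HexVertex → ℂ} (heq : G ∘ Sym2.map rotO = G)
    {w₀ w₁ w₂ : HexVertex} (h₀ : hexGraph.Adj O w₀) (h₁ : hexGraph.Adj O w₁) (h₂ : hexGraph.Adj O w₂) :
    fieldMono G O w₀ w₁ w₂ = 3 * G s(O, nbA) ∧ fieldBelt G O w₀ w₁ w₂ = 0 := by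
  have hAB : G s(O, nbB) = G s(O, nbA) := by
    have := congrFun heq s(O, nbA)
    simpa [Function.comp, Sym2.map_mk, rotO_O, rotO_nbA] using this
  have hBC : G s(O, nbC) = G s(O, nbB) := by
    have := congrFun heq s(O, nbB)
    simpa [Function.comp, Sym2.map_mk, rotO_O, rotO_nbB] using this
  have hval : ∀ w, hexGraph.Adj O w → G s(O, w) = G s(O, nbA) := by
    intro w hw
    rcases Compactness.nbr_cases hw with rfl | rfl | rfl
    · rfl
    · exact hAB
    · exact hBC.trans hAB
  constructor
  · simp only [fieldMono, hval _ h₀, hval _ h₁, hval _ h₂]; ring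
  · simp only [fieldBelt, hval _ h₀, hval _ h₁, hval _ h₂]
    linear_combination (G s(O, nbA)) * Compactness.one_add_omega_add_sq

end Equivalence

open Equivalence

/-- **Liouville ⇒ crux**: under bulk no-fold, if all lattice-scale local limits coincide then (M) holds.
By contradiction through S2 (`stub_compactnessAtOrigin`): a bad normalised local limit `G` with
`G ∘ rotO ∈ LocalLimits` would equal its own rotation, hence be flat at `O` in every frame. -/
theorem interiorFlattening_of_bulkNoFold_of_subsingleton
    (h1 : ∃ k R₀ : ℝ, 0 ≤ k ∧ k < 1 ∧ RatioAtDepth R₀ k) (hsub : LocalLimits.Subsingleton) :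
    Summit.CriticalPhenomena.SAWScalingLimit.Theses.SAWDevelopingMap.InteriorFlattening := by
  obtain ⟨k, R₀, hk0, hk1, hR⟩ := h1
  by_contra hM
  rw [BulkNoFold.interiorFlattening_iff_ratioAtDepth] at hM
  push Not at hM
  obtain ⟨ε, hε, hbadε⟩ := hM
  obtain ⟨G, hG, hGrot, hnorm, w₀, w₁, w₂, ha0, ha1, ha2, -, -, -, hbadG⟩ :=
    stub_compactnessAtOrigin k R₀ ε hk0 hk1 hR hε fun n => hbadε n
  have heq : G ∘ Sym2.map rotO = G := hsub hGrot hG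
  obtain ⟨hcan, -⟩ := modes_of_rot_invariant heq Compactness.adj_O_nbA Compactness.adj_O_nbB
    Compactness.adj_O_nbC
  obtain ⟨hfrm, hbelt0⟩ := modes_of_rot_invariant heq ha0 ha1 ha2
  have hmono1 : fieldMono G O w₀ w₁ w₂ = 1 := by rw [hfrm, ← hcan, hnorm]
  rw [hmono1, hbelt0] at hbadG
  simp only [norm_one, mul_one, norm_zero] at hbadG
  linarith

/-- **`InteriorFlattening` is a lattice Liouville theorem** (registered sub-goal of this file): the crux holds
iff some `k < 1` bounds the Beltrami quotient at all sufficiently deep vertices (S1) AND all lattice-scale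
local limits of normalised observables coincide. -/
theorem interiorFlattening_iff_bulkNoFold_and_subsingleton :
    Summit.CriticalPhenomena.SAWScalingLimit.Theses.SAWDevelopingMap.InteriorFlattening ↔
      (∃ k R₀ : ℝ, 0 ≤ k ∧ k < 1 ∧ RatioAtDepth R₀ k) ∧ LocalLimits.Subsingleton :=
  ⟨fun h => ⟨BulkNoFold.bulkNoFold_of_interiorFlattening h, localLimits_subsingleton_of_interiorFlattening h⟩,
    fun h => interiorFlattening_of_bulkNoFold_of_subsingleton h.1 h.2⟩

/-- The same with the unique limit named: the crux holds iff S1 holds and every local limit is the constant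
field `1/3` on edges. -/
theorem interiorFlattening_iff_bulkNoFold_and_subset_constThird :
    Summit.CriticalPhenomena.SAWScalingLimit.Theses.SAWDevelopingMap.InteriorFlattening ↔
      (∃ k R₀ : ℝ, 0 ≤ k ∧ k < 1 ∧ RatioAtDepth R₀ k) ∧ LocalLimits ⊆ {Necessity.constThird} :=
  ⟨fun h => ⟨BulkNoFold.bulkNoFold_of_interiorFlattening h, localLimits_subset_of_interiorFlattening h⟩,
    fun h => interiorFlattening_of_bulkNoFold_of_subsingleton h.1
      ((Set.subsingleton_singleton).anti h.2)⟩

/-- Under the route's `NoFoldBound` ((K), rank-2 crux stmt-CriticalPhenomena-8296) the crux is EXACTLY the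
Liouville uniqueness of local limits. -/
theorem interiorFlattening_iff_subsingleton_of_noFoldBound
    (hK : Summit.CriticalPhenomena.SAWScalingLimit.Theses.SAWDevelopingMap.NoFoldBound) :
    Summit.CriticalPhenomena.SAWScalingLimit.Theses.SAWDevelopingMap.InteriorFlattening ↔
      LocalLimits.Subsingleton := by
  rw [interiorFlattening_iff_bulkNoFold_and_subsingleton]
  exact ⟨fun h => h.2, fun h => ⟨BulkNoFold.bulkNoFold_of_noFoldBound hK, h⟩⟩

end Summit.CriticalPhenomena.SAWScalingLimit.Theorems.InteriorFlattening.Liouville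

end
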